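import Literature.AlgebraicGeometry.Morphisms.CechH1
import Literature.AlgebraicGeometry.Morphisms.SectionsFlatBaseChange
import HarnessLib

/-!
# Unit Čech `1`-cocycles with coefficients in an algebra (transition functions of line bundles on `X × Spec R`)

Pure commutative algebra over the flat models `Γ(X, U_i ∩ U_j) ⊗_A R` of a scheme `f : X ⟶ Spec A` with a family of
opens `U : ι → X.Opens` and an `A`-algebra `R` («level», e.g. `𝒪_{T,t}/𝔪^{n+1}`):
* §1 `resR` / `coef` / `red` — restriction, change of coefficients and reduction in the models `Γ(V) ⊗_A R`;
* §2 `UCocycle f U R` — multiplicative Čech `1`-cocycles `u_{ij} ∈ (Γ(U_i ∩ U_j) ⊗_A R)^×`, `u_{ij} u_{jk} = u_{ik}`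
  (the transition functions of a line bundle on `X × Spec R` trivialised on the `U_i × Spec R`, [GortzWedhorn2020]
  Prop. 11.15 / (11.6)); change of level `UCocycle.map`, twisting by a unit `0`-cochain `UCocycle.twist`, the relation
  `Rel` («cohomologous via `h`», [Hartshorne1977] III Ex. 4.5), `Rel.symm_units`, `Rel.map`, `SameRed`.
Consumed by `Morphisms/CechUnitCocycleSmallExtension`, `…DifferenceClass`, `…KodairaSpencer` (the Kodaira–Spencer
calculus of [GortzWedhorn2023] Prop. 27.122 and [MumfordAV1970] §13).
HC_CM is proved only modulo the 7 printed citations until rung 0 closes.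

## References
* [GortzWedhorn2020] U. Görtz, T. Wedhorn, *Algebraic Geometry I*, 2nd ed., Prop. 11.15 and Remark 11.16 (line bundles
  by cocycles), (11.6).
* [Hartshorne1977] R. Hartshorne, *Algebraic Geometry*, III Ex. 4.5 (`Pic X ≅ Ȟ¹(X, 𝒪_X^×)`).
* [GortzWedhorn2023] U. Görtz, T. Wedhorn, *Algebraic Geometry II*, Prop. 27.122.
* [MumfordAV1970] D. Mumford, *Abelian Varieties*, §13 (proof of the Thm. p. 125).
-/

noncomputable section

universe u v

open TensorProduct CategoryTheory AlgebraicGeometry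

namespace Literature.AlgebraicGeometry.Morphisms

namespace CechUnitCocycle

variable {A : Type u} [CommRing A] {X : Scheme.{u}} (f : X ⟶ Spec (.of A)) {ι : Type v} (U : ι → X.Opens)

/-! ## §1 Sections with coefficients and their restrictions -/

section Coefficients

variable (R : Type u) [CommRing R] [Algebra A R]

/-- `res ⊗ id_R : Γ(V) ⊗_A R → Γ(W) ⊗_A R` for `W ≤ V` (restriction in the flat model of `X × Spec R`). [folklore] -/
def resR {V W : X.Opens} (h : W ≤ V) : Sections f V ⊗[A] R →ₐ[A] Sections f W ⊗[A] R :=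
  Algebra.TensorProduct.map (Sections.res f h) (AlgHom.id A R)

variable {R}

/-- `resR` on pure tensors. [cite: StacksProject, Tag 02KE] -/
@[simp] theorem resR_tmul {V W : X.Opens} (h : W ≤ V) (s : Sections f V) (r : R) :
    resR f R h (s ⊗ₜ r) = Sections.res f h s ⊗ₜ r := by
  simp [resR, Algebra.TensorProduct.map_tmul]

/-- Proof-irrelevance of `resR` in the inequality. [cite: StacksProject, Tag 02KE] -/
theorem resR_irrel {V W : X.Opens} (h h' : W ≤ V) (x : Sections f V ⊗[A] R) : resR f R h x = resR f R h' x := rfl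

/-- Transitivity of `resR`. [cite: StacksProject, Tag 02KE] -/
theorem resR_resR {V W W' : X.Opens} (h : W ≤ V) (h' : W' ≤ W) (x : Sections f V ⊗[A] R) :
    resR f R h' (resR f R h x) = resR f R (h'.trans h) x := by
  induction x using TensorProduct.induction_on with
  | zero => simp
  | tmul s r => simp [Sections.res_res]
  | add x y hx hy => simp [hx, hy]

/-- Change of coefficients `id ⊗ φ`. [folklore] -/
abbrev coef {R' : Type u} [CommRing R'] [Algebra A R'] (φ : R →ₐ[A] R') (V : X.Opens) :
    Sections f V ⊗[A] R →ₐ[A] Sections f V ⊗[A] R' :=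
  Algebra.TensorProduct.map (AlgHom.id A (Sections f V)) φ

/-- `coef φ` on pure tensors. [cite: StacksProject, Tag 02KE] -/
@[simp] theorem coef_tmul {R' : Type u} [CommRing R'] [Algebra A R'] (φ : R →ₐ[A] R') (V : X.Opens)
    (s : Sections f V) (r : R) : coef f φ V (s ⊗ₜ r) = s ⊗ₜ φ r := by
  simp [Algebra.TensorProduct.map_tmul]

/-- Restriction commutes with change of coefficients. [cite: StacksProject, Tag 02KE] -/
theorem resR_coef {R' : Type u} [CommRing R'] [Algebra A R'] (φ : R →ₐ[A] R') {V W : X.Opens} (h : W ≤ V)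
    (x : Sections f V ⊗[A] R) : resR f R' h (coef f φ V x) = coef f φ W (resR f R h x) := by
  induction x using TensorProduct.induction_on with
  | zero => simp
  | tmul s r => simp
  | add x y hx hy => simp [hx, hy]

/-- `coef` is functorial. [cite: StacksProject, Tag 02KE] -/
theorem coef_comp {R' R'' : Type u} [CommRing R'] [Algebra A R'] [CommRing R''] [Algebra A R'']
    (φ : R →ₐ[A] R') (ψ : R' →ₐ[A] R'') (V : X.Opens) (x : Sections f V ⊗[A] R) :
    coef f (ψ.comp φ) V x = coef f ψ V (coef f φ V x) := by
  induction x using TensorProduct.induction_on with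
  | zero => simp
  | tmul s r => simp
  | add x y hx hy => simp [hx, hy]

/-- The reduction `Γ(V) ⊗_A R → Γ(V) ⊗_A A = Γ(V)` along an augmentation `ρ : R → A`. [folklore] -/
def red (ρ : R →ₐ[A] A) (V : X.Opens) : Sections f V ⊗[A] R →ₐ[A] Sections f V :=
  (Algebra.TensorProduct.rid A A (Sections f V)).toAlgHom.comp (coef f ρ V)

/-- `red` on pure tensors. [cite: StacksProject, Tag 02KE] -/
@[simp] theorem red_tmul (ρ : R →ₐ[A] A) (V : X.Opens) (s : Sections f V) (r : R) :
    red f ρ V (s ⊗ₜ r) = ρ r • s := by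
  simp [red, Algebra.TensorProduct.rid_tmul]

/-- Restriction commutes with reduction. [cite: StacksProject, Tag 02KE] -/
theorem res_red (ρ : R →ₐ[A] A) {V W : X.Opens} (h : W ≤ V) (x : Sections f V ⊗[A] R) :
    Sections.res f h (red f ρ V x) = red f ρ W (resR f R h x) := by
  induction x using TensorProduct.induction_on with
  | zero => simp
  | tmul s r => simp
  | add x y hx hy => simp only [map_add, hx, hy]

/-- Reduction after change of coefficients. [cite: StacksProject, Tag 02KE] -/
theorem red_coef {R' : Type u} [CommRing R'] [Algebra A R'] (φ : R →ₐ[A] R') (ρ' : R' →ₐ[A] A) (V : X.Opens)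
    (x : Sections f V ⊗[A] R) : red f ρ' V (coef f φ V x) = red f (ρ'.comp φ) V x := by
  induction x using TensorProduct.induction_on with
  | zero => simp
  | tmul s r => simp
  | add x y hx hy => simp only [map_add, hx, hy]

end Coefficients

/-! ## §2 Unit `1`-cocycles with coefficients -/

section Cocycles

variable {f U}

/-- The three faces `U_{ijk} ≤ U_{ij}, U_{jk}, U_{ik}` (conventions of `Morphisms.cechD1`). [cite: GortzWedhorn2020, Prop. 11.15 and Remark 11.16] -/
theorem le12 (i j k : ι) : U i ⊓ U j ⊓ U k ≤ U i ⊓ U j := inf_le_left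
/-- See `le12`. [cite: GortzWedhorn2020, Prop. 11.15 and Remark 11.16] -/
theorem le23 (i j k : ι) : U i ⊓ U j ⊓ U k ≤ U j ⊓ U k := le_inf (inf_le_left.trans inf_le_right) inf_le_right
/-- See `le12`. [cite: GortzWedhorn2020, Prop. 11.15 and Remark 11.16] -/
theorem le13 (i j k : ι) : U i ⊓ U j ⊓ U k ≤ U i ⊓ U k := le_inf (inf_le_left.trans inf_le_left) inf_le_right

variable (f U)
variable (R : Type u) [CommRing R] [Algebra A R]

/-- **A unit Čech `1`-cocycle with coefficients in `R`**: units `u_{ij} ∈ Γ(U_i ∩ U_j) ⊗_A R` with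
`u_{ij}|·u_{jk}| = u_{ik}|` on `U_{ijk}` — the transition functions `e_i = u_{ij} e_j` of a line bundle on
`X × Spec R` with frames `e_i` over `U_i × Spec R`. [cite: StacksProject, Tag 01ED] -/
structure UCocycle where
  /-- the transition functions -/
  val : (i j : ι) → Sections f (U i ⊓ U j) ⊗[A] R
  /-- they are units -/
  isUnit : ∀ i j, IsUnit (val i j)
  /-- the cocycle identity `u_{ij} u_{jk} = u_{ik}` on triple overlaps -/
  cocycle : ∀ i j k, resR f R (le12 i j k) (val i j) * resR f R (le23 i j k) (val j k) =
    resR f R (le13 i j k) (val i k)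

/-- Unit `0`-cochains with coefficients in `R`. [folklore] -/
abbrev UCochain0 : Type (max u v) := (i : ι) → (Sections f (U i) ⊗[A] R)ˣ

variable {f U R}

namespace UCocycle

/-- Change of level of a unit cocycle along `φ : R → R'`. [folklore] -/
def map {R' : Type u} [CommRing R'] [Algebra A R'] (u : UCocycle f U R) (φ : R →ₐ[A] R') : UCocycle f U R' where
  val i j := coef f φ _ (u.val i j)
  isUnit i j := (u.isUnit i j).map _
  cocycle i j k := by
    rw [resR_coef, resR_coef, resR_coef, ← map_mul, u.cocycle]

/-- `map` evaluates as `id ⊗ φ`. [cite: GortzWedhorn2020, Prop. 11.15 and Remark 11.16] -/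
@[simp] theorem map_val {R' : Type u} [CommRing R'] [Algebra A R'] (u : UCocycle f U R) (φ : R →ₐ[A] R') (i j : ι) :
    (u.map φ).val i j = coef f φ _ (u.val i j) := rfl

/-- `map` is functorial. [cite: GortzWedhorn2020, Prop. 11.15 and Remark 11.16] -/
theorem map_map_val {R' R'' : Type u} [CommRing R'] [Algebra A R'] [CommRing R''] [Algebra A R'']
    (u : UCocycle f U R) (φ : R →ₐ[A] R') (ψ : R' →ₐ[A] R'') (i j : ι) :
    ((u.map φ).map ψ).val i j = (u.map (ψ.comp φ)).val i j := by
  simp [coef_comp]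

/-- Restrictions of a unit `0`-cochain to an overlap cancel: `h_j|⁻¹ · h_j| = 1`. [cite: GortzWedhorn2020, Prop. 11.15 and Remark 11.16] -/
theorem res_inv_mul {V W : X.Opens} (hle : W ≤ V) (x : (Sections f V ⊗[A] R)ˣ) :
    resR f R hle ↑x⁻¹ * resR f R hle ↑x = 1 := by
  rw [← map_mul, Units.inv_mul, map_one]

/-- See `res_inv_mul`. [cite: GortzWedhorn2020, Prop. 11.15 and Remark 11.16] -/
theorem res_mul_inv {V W : X.Opens} (hle : W ≤ V) (x : (Sections f V ⊗[A] R)ˣ) :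
    resR f R hle ↑x * resR f R hle ↑x⁻¹ = 1 := by
  rw [← map_mul, Units.mul_inv, map_one]

/-- **Twisting a unit cocycle by a unit `0`-cochain** `h`: `u^h_{ij} := h_i| · u_{ij} · h_j|⁻¹` (change of frames
`e'_i = h_i e_i`). [folklore] -/
def twist (u : UCocycle f U R) (h : UCochain0 f U R) : UCocycle f U R where
  val i j := resR f R (inf_le_left : U i ⊓ U j ≤ U i) ↑(h i) * u.val i j *
    resR f R (inf_le_right : U i ⊓ U j ≤ U j) ↑(h j)⁻¹
  isUnit i j := (((h i).isUnit.map _).mul (u.isUnit i j)).mul ((h j)⁻¹.isUnit.map _)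
  cocycle i j k := by
    have hi : resR f R (le12 i j k) (resR f R (inf_le_left : U i ⊓ U j ≤ U i) ↑(h i)) =
        resR f R (le13 i j k) (resR f R (inf_le_left : U i ⊓ U k ≤ U i) ↑(h i)) := by
      rw [resR_resR, resR_resR]
    have hj : resR f R (le12 i j k) (resR f R (inf_le_right : U i ⊓ U j ≤ U j) ↑(h j)⁻¹) =
        resR f R (le23 i j k) (resR f R (inf_le_left : U j ⊓ U k ≤ U j) ↑(h j)⁻¹) := by
      rw [resR_resR, resR_resR]
    have hj' : resR f R (le12 i j k) (resR f R (inf_le_right : U i ⊓ U j ≤ U j) ↑(h j)) =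
        resR f R (le23 i j k) (resR f R (inf_le_left : U j ⊓ U k ≤ U j) ↑(h j)) := by
      rw [resR_resR, resR_resR]
    have hk : resR f R (le23 i j k) (resR f R (inf_le_right : U j ⊓ U k ≤ U k) ↑(h k)⁻¹) =
        resR f R (le13 i j k) (resR f R (inf_le_right : U i ⊓ U k ≤ U k) ↑(h k)⁻¹) := by
      rw [resR_resR, resR_resR]
    have cancel : resR f R (le12 i j k) (resR f R (inf_le_right : U i ⊓ U j ≤ U j) ↑(h j)⁻¹) *
        resR f R (le23 i j k) (resR f R (inf_le_left : U j ⊓ U k ≤ U j) ↑(h j)) = 1 := by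
      rw [hj, ← map_mul, res_inv_mul, map_one]
    calc resR f R (le12 i j k) (resR f R inf_le_left ↑(h i) * u.val i j * resR f R inf_le_right ↑(h j)⁻¹) *
          resR f R (le23 i j k) (resR f R inf_le_left ↑(h j) * u.val j k * resR f R inf_le_right ↑(h k)⁻¹)
        = resR f R (le12 i j k) (resR f R inf_le_left ↑(h i)) *
            (resR f R (le12 i j k) (u.val i j) * resR f R (le23 i j k) (u.val j k)) *
            (resR f R (le12 i j k) (resR f R (inf_le_right : U i ⊓ U j ≤ U j) ↑(h j)⁻¹) *
              resR f R (le23 i j k) (resR f R (inf_le_left : U j ⊓ U k ≤ U j) ↑(h j))) *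
            resR f R (le23 i j k) (resR f R (inf_le_right : U j ⊓ U k ≤ U k) ↑(h k)⁻¹) := by
          simp only [map_mul]; ring
      _ = resR f R (le13 i j k) (resR f R inf_le_left ↑(h i) * u.val i k * resR f R inf_le_right ↑(h k)⁻¹) := by
          rw [cancel, mul_one, u.cocycle, hi, hk, map_mul, map_mul]

/-- The value of a twist, multiplied back: `u^h_{ij} · h_j| = h_i| · u_{ij}`. [cite: GortzWedhorn2020, Prop. 11.15 and Remark 11.16] -/
theorem twist_val_mul (u : UCocycle f U R) (h : UCochain0 f U R) (i j : ι) :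
    (u.twist h).val i j * resR f R (inf_le_right : U i ⊓ U j ≤ U j) ↑(h j) =
      resR f R (inf_le_left : U i ⊓ U j ≤ U i) ↑(h i) * u.val i j := by
  change resR f R inf_le_left ↑(h i) * u.val i j * resR f R (inf_le_right : U i ⊓ U j ≤ U j) ↑(h j)⁻¹ *
    resR f R inf_le_right ↑(h j) = _
  rw [mul_assoc, res_inv_mul, mul_one]

/-- The value of a twist. [cite: GortzWedhorn2020, Prop. 11.15 and Remark 11.16] -/
theorem twist_val (u : UCocycle f U R) (h : UCochain0 f U R) (i j : ι) :
    (u.twist h).val i j = resR f R (inf_le_left : U i ⊓ U j ≤ U i) ↑(h i) * u.val i j *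
      resR f R (inf_le_right : U i ⊓ U j ≤ U j) ↑(h j)⁻¹ := rfl

end UCocycle

/-- `u'` is obtained from `u` by the `0`-cochain `h` («cohomologous via `h`»):
`h_i| · u_{ij} = u'_{ij} · h_j|`. [cite: StacksProject, Tag 01ED] -/
def Rel (u u' : UCocycle f U R) (h : (i : ι) → Sections f (U i) ⊗[A] R) : Prop :=
  ∀ i j, resR f R (inf_le_left : U i ⊓ U j ≤ U i) (h i) * u.val i j =
    u'.val i j * resR f R (inf_le_right : U i ⊓ U j ≤ U j) (h j)

/-- A twist is related to the original cocycle by the twisting cochain. [cite: GortzWedhorn2020, Prop. 11.15 and Remark 11.16] -/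
theorem rel_twist (u : UCocycle f U R) (h : UCochain0 f U R) : Rel u (u.twist h) (fun i => ↑(h i)) :=
  fun i j => (u.twist_val_mul h i j).symm

/-- `Rel` along a unit cochain is symmetric (with the inverse cochain). [cite: GortzWedhorn2020, Prop. 11.15 and Remark 11.16] -/
theorem Rel.symm_units {u u' : UCocycle f U R} {h : UCochain0 f U R} (hr : Rel u u' (fun i => ↑(h i))) :
    Rel u' u (fun i => ↑(h i)⁻¹) := by
  intro i j
  show resR f R (inf_le_left : U i ⊓ U j ≤ U i) ↑(h i)⁻¹ * u'.val i j =
    u.val i j * resR f R (inf_le_right : U i ⊓ U j ≤ U j) ↑(h j)⁻¹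
  have hij : resR f R (inf_le_left : U i ⊓ U j ≤ U i) ↑(h i) * u.val i j =
      u'.val i j * resR f R (inf_le_right : U i ⊓ U j ≤ U j) ↑(h j) := hr i j
  have e1 : u'.val i j = resR f R (inf_le_left : U i ⊓ U j ≤ U i) ↑(h i) * u.val i j *
      resR f R (inf_le_right : U i ⊓ U j ≤ U j) ↑(h j)⁻¹ := by
    rw [hij, mul_assoc, UCocycle.res_mul_inv, mul_one]
  rw [e1, ← mul_assoc, ← mul_assoc, UCocycle.res_inv_mul, one_mul]

/-- `Rel` is transported along change of coefficients. [cite: GortzWedhorn2020, Prop. 11.15 and Remark 11.16] -/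
theorem Rel.map {R' : Type u} [CommRing R'] [Algebra A R'] {u u' : UCocycle f U R} {h : (i : ι) → Sections f (U i) ⊗[A] R}
    (hr : Rel u u' h) (φ : R →ₐ[A] R') : Rel (u.map φ) (u'.map φ) (fun i => coef f φ _ (h i)) := by
  intro i j
  simp only [UCocycle.map_val, resR_coef, ← map_mul, hr i j]

end Cocycles

end CechUnitCocycle

end Literature.AlgebraicGeometry.Morphisms

end
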